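import Literature.MathematicalPhysics.QuantumFieldTheory.Balaban1983to89.B6Prop26PrintedStage2KLevelV1
import Literature.MathematicalPhysics.QuantumFieldTheory.Balaban1983to89.B6Ineq2140GradGDivCensusKLevelV1
import HarnessLib

/-!
# `Balaban1983to89.B6Prop26PrintedStage3KLevelV1` — T. Bałaban, *Propagators and renormalization transformations for lattice gauge theories. II*,
Commun. Math. Phys. **96** (1984) 223–250 [Balaban1984PropagatorsII], Prop. 2.6 (2.136)–(2.141) p. 247: **`h26 = Prop26Printed` ON THE GENUINE
k-LEVEL CENSUS MODULO FIVE DISPLAYED SLOTS** — Stage 3 of the slot-discharge ladder: the slot `hl3` ((2.140)₄ `∇G(𝔅)∇*`) of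
`B6Prop26PrintedStage2KLevelV1.prop26Printed_kLevel_of_slots5` is discharged by `B6Ineq2140GradGDivCensusKLevelV1.ineq2140_gradGDiv_kLevel_census`
(cell pub-ymgap, seat dag-p1; lit-balaban GAPS G-B6-2140-456).  Remaining displayed inputs: hm2 ((2.137) pair majorant of `G∇*`), hl4 ((2.140)₅ `∇∇G`),
hl5 ((2.140)₆ `G∇*∇*`), c3 ((2.138)), c4 ((2.139)) — shapes verbatim.
HONEST FRAMING (programme rule): statement-level skeleton of published theorems with citation tags; proofs where landed; nothing here is a claim about
the Yang–Mills mass gap.  One-line composition of named census theorems; THEOREMS ONLY; a T1 landing, NOT a node discharge; nothing continuum ∕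
mass-gap ∕ Clay.  Seat `pub-ymgap-dag-p1` (prover), 2026-08-25.  NOT summit progress.
-/

namespace Literature.MathematicalPhysics.QuantumFieldTheory.Balaban1983to89.B6Prop26PrintedStage3KLevelV1

open LatticeFieldCalculus
open B6SectAOperatorsV1 (BondIdx)
open B6SectAVectorModelV1 (GE)
open B6Ineq2133TwoScaleV1 (onFun)
open B6MultiLevelBoxOperator (N0)
open B6MultiLevelTorusOperator (TDomains)
open B6GlobalChartV1 (PV domT blkV1)
open B6Geom246MultiLevelTorus (geomT)
open B6CubeWindowV1 (Placed GlobalBand)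
open B6Cover236MultiLevelBlocks (cubes)
open B6GradLegKLevelV1 (DV)
open B6LapLegKLevelV1 (DVa)
open B6HolderPairMemberV1 (pairOp)
open B6RandomWalk (HasMajorant)
open B6KLevelCensusIndexV1 (KIdx kGeoG)
open B6Prop26Census2136KLevelV1 (kG)

open B6Prop26PrintedStage2KLevelV1 (prop26Printed_kLevel_of_slots5)
open B6Ineq2140GradGDivCensusKLevelV1 (ineq2140_gradGDiv_kLevel_census)

variable {d ℓ : ℕ} {hd : 1 ≤ d + 1} {hL : Odd (ℓ + 1) ∧ 1 < ℓ + 1} {b₀ b₁ : ℝ}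

noncomputable section

/-- **`h26` ON THE GENUINE k-LEVEL CENSUS, MODULO FIVE DISPLAYED SLOTS** (hm2, hl4, hl5, c3, c4 — shapes of
`B6Prop26PrintedStage2KLevelV1.prop26Printed_kLevel_of_slots5` verbatim; hl3 discharged by `ineq2140_gradGDiv_kLevel_census`).
[cite: Balaban1984PropagatorsII, Prop. 2.6 (2.136)–(2.141) p.247] -/
theorem prop26Printed_kLevel_of_slots4 (hb₀ : 0 < b₀) (hb₁ : b₀ ≤ b₁)
    (hm2 : ∃ (δ M₂ : ℝ) (N₁ : ℕ), 0 < δ ∧ 0 < M₂ ∧ ∀ (α : ℝ), 0 ≤ α → α < 1 → ∃ A : ℝ, 0 ≤ A ∧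
      ∀ (m K : ℕ) {Mh k R : ℕ} {P' : Fin (d + 1) → ℕ}
        (hN : ∀ μ, N0 ℓ Mh k P' μ = (PV d ℓ m K hd hL).sitesPerDir 0) (D : TDomains d ℓ Mh k P' R) (hk : k ≤ m + K) (_ : 2 ≤ k)
        {a : ℕ} (_ : Mh = (ℓ + 1) ^ a) (_ : 8 ≤ Mh) (_ : 2 * (ℓ + 1) ^ 2 ≤ R) (_ : ∀ μ, 5 ≤ P' μ) (_ : 4 ≤ ℓ)
        (_ : ∀ c : ↥(cubes D.toDomains), Placed ℓ k P' c.1) (_ : M₂ ≤ ((ℓ : ℝ) + 1) * Mh) (_ : N₁ + 1 ≤ R * ((ℓ + 1) * Mh))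
        {cf : ℝ} (hcf : cf ≠ 0) {w : BondIdx (domT hN D hk) → ℝ} (hw : ∀ i, 0 < w i) (_ : GlobalBand b₀ b₁ cf w)
        (ν : Fin (d + 1)) (x x' : PBond (PV d ℓ m K hd hL) 0), x.dir = x'.dir →
        supDist x.src x'.src ≤ (ℓ + 1) ^ (blkV1 hN D x).1.1 → supDist x.src x'.src ≤ (ℓ + 1) ^ (blkV1 hN D x').1.1 →
        HasMajorant (g := geomT D) (blkV1 hN D) (pairOp x x' * onFun (GE (domT hN D hk) hcf hw) * DVa ν cf)
          (fun y y' => A * ((((supDist x.src x'.src : ℕ) : ℝ) / (((ℓ + 1 : ℕ) : ℝ)) ^ (blkV1 hN D x).1.1) ^ α *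
            ((geomT D).len y * |cf|⁻¹)) * Real.exp (-(δ * (geomT D).dist y y'))))
    (hl4 : ∃ (δ A M₂ : ℝ) (N₁ : ℕ), 0 < δ ∧ 0 ≤ A ∧ 0 < M₂ ∧
      ∀ (m K : ℕ) {Mh k R : ℕ} {P' : Fin (d + 1) → ℕ}
        (hN : ∀ μ, N0 ℓ Mh k P' μ = (PV d ℓ m K hd hL).sitesPerDir 0) (D : TDomains d ℓ Mh k P' R) (hk : k ≤ m + K) (_ : 2 ≤ k)
        {a : ℕ} (_ : Mh = (ℓ + 1) ^ a) (_ : 8 ≤ Mh) (_ : 2 * (ℓ + 1) ^ 2 ≤ R) (_ : ∀ μ, 5 ≤ P' μ) (_ : 4 ≤ ℓ)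
        (_ : ∀ c : ↥(cubes D.toDomains), Placed ℓ k P' c.1) (_ : M₂ ≤ ((ℓ : ℝ) + 1) * Mh) (_ : N₁ + 1 ≤ R * ((ℓ + 1) * Mh))
        {cf : ℝ} (hcf : cf ≠ 0) {w : BondIdx (domT hN D hk) → ℝ} (hw : ∀ i, 0 < w i) (_ : GlobalBand b₀ b₁ cf w)
        (ν μ : Fin (d + 1)) (y y' : (geomT D).Site) (ζ J : PBond (PV d ℓ m K hd hL) 0 → ℝ) {s : ℝ} (_ : 0 ≤ s)
        (_ : ∀ x, blkV1 hN D x ≠ y → ζ x = 0) (_ : ∀ x, |ζ x| ≤ s) (_ : ∀ x, blkV1 hN D x ≠ y' → J x = 0),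
        ∑ x, (ζ x * (DV ν cf ∘ₗ DV μ cf ∘ₗ onFun (GE (domT hN D hk) hcf hw)) J x) ^ 2 ≤
          (A * Real.exp (-(δ * (geomT D).dist y y')) * s) ^ 2 * ∑ x, J x ^ 2)
    (hl5 : ∃ (δ A M₂ : ℝ) (N₁ : ℕ), 0 < δ ∧ 0 ≤ A ∧ 0 < M₂ ∧
      ∀ (m K : ℕ) {Mh k R : ℕ} {P' : Fin (d + 1) → ℕ}
        (hN : ∀ μ, N0 ℓ Mh k P' μ = (PV d ℓ m K hd hL).sitesPerDir 0) (D : TDomains d ℓ Mh k P' R) (hk : k ≤ m + K) (_ : 2 ≤ k)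
        {a : ℕ} (_ : Mh = (ℓ + 1) ^ a) (_ : 8 ≤ Mh) (_ : 2 * (ℓ + 1) ^ 2 ≤ R) (_ : ∀ μ, 5 ≤ P' μ) (_ : 4 ≤ ℓ)
        (_ : ∀ c : ↥(cubes D.toDomains), Placed ℓ k P' c.1) (_ : M₂ ≤ ((ℓ : ℝ) + 1) * Mh) (_ : N₁ + 1 ≤ R * ((ℓ + 1) * Mh))
        {cf : ℝ} (hcf : cf ≠ 0) {w : BondIdx (domT hN D hk) → ℝ} (hw : ∀ i, 0 < w i) (_ : GlobalBand b₀ b₁ cf w)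
        (ν μ : Fin (d + 1)) (y y' : (geomT D).Site) (ζ J : PBond (PV d ℓ m K hd hL) 0 → ℝ) {s : ℝ} (_ : 0 ≤ s)
        (_ : ∀ x, blkV1 hN D x ≠ y → ζ x = 0) (_ : ∀ x, |ζ x| ≤ s) (_ : ∀ x, blkV1 hN D x ≠ y' → J x = 0),
        ∑ x, (ζ x * (onFun (GE (domT hN D hk) hcf hw) ∘ₗ DVa ν cf ∘ₗ DVa μ cf) J x) ^ 2 ≤
          (A * Real.exp (-(δ * (geomT D).dist y y')) * s) ^ 2 * ∑ x, J x ^ 2)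
    (c3 : ∃ M₁ δ₃ : ℝ, ∃ Cε : ℝ → ℝ, 0 < M₁ ∧ 0 < δ₃ ∧ ∀ i : KIdx d ℓ hd hL b₀ b₁, M₁ ≤ (kGeoG i).M →
      ∀ (ε : ℝ) (J : (kGeoG i).Loc) (y y' : (kGeoG i).Site), 0 < ε → ε < 1 → (kGeoG i).suppIn J y' →
        (kG i).e4 J y ≤ Cε ε * Real.exp (-(δ₃ * (kGeoG i).dist y y')) * ((kGeoG i).holder ε J + (kGeoG i).supNorm J))
    (c4 : ∃ M₁ δ₃ : ℝ, ∃ Cαε : ℝ → ℝ → ℝ, 0 < M₁ ∧ 0 < δ₃ ∧ ∀ i : KIdx d ℓ hd hL b₀ b₁, M₁ ≤ (kGeoG i).M →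
      ∀ (α ε : ℝ) (J : (kGeoG i).Loc) (ζ : (kGeoG i).Cut) (y y' : (kGeoG i).Site), 0 ≤ α → 0 < ε → α + ε < 1 →
        (kGeoG i).cutIn ζ y → (kGeoG i).suppIn J y' →
        (kG i).h2 J α ζ ≤ Cαε α ε * ((kGeoG i).len y) ^ (-α) * (kGeoG i).cutH α ζ * Real.exp (-(δ₃ * (kGeoG i).dist y y')) *
          ((kGeoG i).holder (α + ε) J + (kGeoG i).supNorm J)) :
    B6.Prop26Printed (fun i : KIdx d ℓ hd hL b₀ b₁ => kGeoG i) (fun i => kG i) :=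
  prop26Printed_kLevel_of_slots5 hb₀ hb₁ hm2 (ineq2140_gradGDiv_kLevel_census hb₀ hb₁) hl4 hl5 c3 c4

end

end Literature.MathematicalPhysics.QuantumFieldTheory.Balaban1983to89.B6Prop26PrintedStage3KLevelV1
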